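import Mathlib

/-!
# Route GeneratorObstructions — crux K1 `PerGenDegreeSuperQP` (stmt-ValiantsHypothesis-11654), line
# `per-side-atoms`: the permanent of the HUB MATRIX (combinatorial core of the padded-gadget degeneration)

Helper file (`--supports stmt-ValiantsHypothesis-11654`).  Index the rows/columns by
`Option (Fin c × Fin L)` (`none` = the hub).  The hub matrix `hubMat z ℓ` carries `z` on every diagonal
entry except the hub's, `z` on the hub-row entries `(hub, (j,0))`, and the row letter `ℓ (j,t)` on the
path entries `((j,t),(j,t+1))` and the closing entries `((j,L-1), hub)`.  A permutation with nonzero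
product must enter the hub column from the end of exactly one block `j`, which forces the whole
block-`j` path and the hub edge and pins every other column to its diagonal
(`eq_hubSwitch_of_forall_ne_zero`); hence `permanent_hubMat`:
`per (hubMat z ℓ) = Σ_j z^{(c-1)L+1} · ∏_t ℓ (j,t)`.  The companion file `…PerGenDegreeSuperQPPaddedGadget`
turns this into the orbit-closure membership of the padded doubling gadget in `Δ(per_m)`.

Honest framing: finite combinatorics; no stub, crux or summit is settled here; `VP ≠ VNP` untouched.
[folklore]
-/

namespace Summit.ValiantsHypothesis.ValiantsHypothesis.Theorems.GeneratorObstructions.PerGenDegreeSuperQP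

-- `Summit.ValiantsHypothesis.ValiantsHypothesis.…` is the tree's mandated single-conjunct layout.
set_option linter.dupNamespace false

noncomputable section

/-! ## §1 The hub matrix and its switches -/

section Hub

variable {R : Type*} [CommRing R] {c L : ℕ}

/-- **The hub matrix** on `Option (Fin c × Fin L)` (`none` = hub): `z` on the diagonal except at the
hub, `z` on the hub-row entries `(hub, (j,0))`, the row letter `ℓ (j,t)` on the path entry
`((j,t),(j,t+1))` and on the closing entry `((j,L-1), hub)`; `0` elsewhere. [folklore] -/
def hubMat (z : R) (ℓ : Fin c × Fin L → R) :
    Matrix (Option (Fin c × Fin L)) (Option (Fin c × Fin L)) R := fun x y =>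
  match x, y with
  | none, none => 0
  | none, some q => if q.2.val = 0 then z else 0
  | some p, none => if p.2.val = L - 1 then ℓ p else 0
  | some p, some q => if p = q then z else if p.1 = q.1 ∧ q.2.val = p.2.val + 1 then ℓ p else 0

/-- The row feeding column `y` in the `j`-th switch: the hub column is fed by `(j, L-1)`, column
`(j, 0)` by the hub, column `(j, t+1)` by `(j, t)`, every other column by itself. [folklore] -/
def hubSwitchFun (hL : 1 ≤ L) (j : Fin c) : Option (Fin c × Fin L) → Option (Fin c × Fin L)
  | none => some (j, ⟨L - 1, by omega⟩)
  | some q => if q.1 = j then (if q.2.val = 0 then none else some (j, ⟨q.2.val - 1, by omega⟩))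
      else some q

/-- The inverse assignment. [folklore] -/
def hubSwitchInv (hL : 1 ≤ L) (j : Fin c) : Option (Fin c × Fin L) → Option (Fin c × Fin L)
  | none => some (j, ⟨0, by omega⟩)
  | some p => if p.1 = j then (if h : p.2.val = L - 1 then none else some (j, ⟨p.2.val + 1, by omega⟩))
      else some p

/-- **The `j`-th switch** (column ↦ row), a permutation of the index set. [folklore] -/
def hubSwitch (hL : 1 ≤ L) (j : Fin c) : Equiv.Perm (Option (Fin c × Fin L)) where
  toFun := hubSwitchFun hL j
  invFun := hubSwitchInv hL j
  left_inv x := by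
    rcases x with _ | ⟨j', t⟩
    · simp [hubSwitchFun, hubSwitchInv]
    · by_cases hj : j' = j
      · subst hj
        by_cases ht : t.val = 0
        · obtain ⟨tv, htv⟩ := t
          simp only at ht
          subst ht
          simp [hubSwitchFun, hubSwitchInv]
        · have h1 : t.val - 1 ≠ L - 1 := by omega
          simp only [hubSwitchFun, hubSwitchInv, if_true, ht, if_false, h1, dif_neg, not_false_eq_true,
            Option.some.injEq, Prod.mk.injEq, true_and]
          exact Fin.ext (by simp only; omega)
      · simp [hubSwitchFun, hubSwitchInv, hj]
  right_inv x := by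
    rcases x with _ | ⟨j', t⟩
    · simp [hubSwitchInv, hubSwitchFun]
    · by_cases hj : j' = j
      · subst hj
        by_cases ht : t.val = L - 1
        · obtain ⟨tv, htv⟩ := t
          simp only at ht
          subst ht
          simp [hubSwitchFun, hubSwitchInv]
        · have h1 : t.val + 1 ≠ 0 := by omega
          simp only [hubSwitchFun, hubSwitchInv, if_true, ht, dif_neg, h1, if_false, not_false_eq_true,
            Option.some.injEq, Prod.mk.injEq, true_and]
          exact Fin.ext (by simp only; omega)
      · simp [hubSwitchFun, hubSwitchInv, hj]

/-- Values of the switch. [folklore] -/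
theorem hubSwitch_none (hL : 1 ≤ L) (j : Fin c) :
    hubSwitch hL j none = some (j, ⟨L - 1, by omega⟩) := rfl

/-- Values of the switch. [folklore] -/
theorem hubSwitch_some (hL : 1 ≤ L) (j : Fin c) (q : Fin c × Fin L) :
    hubSwitch hL j (some q) = if q.1 = j then
      (if q.2.val = 0 then none else some (j, ⟨q.2.val - 1, by omega⟩)) else some q := rfl

/-- `hubSwitch` is injective in `j` (`c ≥ 1` implicit in `j`). [folklore] -/
theorem hubSwitch_injective (hL : 1 ≤ L) : Function.Injective (hubSwitch (c := c) hL) := by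
  intro j j' h
  have := congrArg (fun σ => σ none) h
  simp only [hubSwitch_none, Option.some.injEq, Prod.mk.injEq] at this
  exact this.1

/-! ## §2 Forcing: a permutation with nonzero product is a switch -/

variable {z : R} {ℓ : Fin c × Fin L → R}

/-- Nonzero entries of the hub column come from block ends. [folklore] -/
theorem hubMat_none_ne_zero {x : Option (Fin c × Fin L)} (h : hubMat z ℓ x none ≠ 0) :
    ∃ j : Fin c, x = some (j, ⟨L - 1, by
      rcases x with _ | ⟨p1, p2⟩
      · exact absurd rfl h
      · have := p2.isLt; omega⟩) := by
  rcases x with _ | ⟨p1, p2⟩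
  · exact absurd rfl h
  · simp only [hubMat] at h
    by_cases hp : p2.val = L - 1
    · exact ⟨p1, by congr 1; ext <;> simp [hp]⟩
    · exact absurd (if_neg hp) (fun h' => h (by rw [h']))

/-- Nonzero entries of a block column `(j,t)`: the diagonal, the predecessor `(j,t-1)` (`t ≥ 1`), or
the hub (`t = 0`). [folklore] -/
theorem hubMat_some_ne_zero {x : Option (Fin c × Fin L)} {q : Fin c × Fin L}
    (h : hubMat z ℓ x (some q) ≠ 0) :
    x = some q ∨ (x = none ∧ q.2.val = 0) ∨
      (∃ p : Fin c × Fin L, x = some p ∧ p.1 = q.1 ∧ q.2.val = p.2.val + 1) := by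
  rcases x with _ | p
  · simp only [hubMat] at h
    by_cases hq : q.2.val = 0
    · exact Or.inr (Or.inl ⟨rfl, hq⟩)
    · exact absurd (if_neg hq) (fun h' => h (by rw [h']))
  · simp only [hubMat] at h
    by_cases hpq : p = q
    · exact Or.inl (by rw [hpq])
    · rw [if_neg hpq] at h
      by_cases h2 : p.1 = q.1 ∧ q.2.val = p.2.val + 1
      · exact Or.inr (Or.inr ⟨p, rfl, h2.1, h2.2⟩)
      · exact absurd (if_neg h2) (fun h' => h (by rw [h']))

/-- **Forcing.** A permutation all of whose entries `hubMat (σ y) y` are nonzero is a switch.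
[folklore] -/
theorem eq_hubSwitch_of_forall_ne_zero (hL : 1 ≤ L) (σ : Equiv.Perm (Option (Fin c × Fin L)))
    (h : ∀ y, hubMat z ℓ (σ y) y ≠ 0) : ∃ j, σ = hubSwitch hL j := by
  -- the block entering the hub column
  obtain ⟨j, hj⟩ := hubMat_none_ne_zero (h none)
  refine ⟨j, ?_⟩
  -- block `j`: descending induction along the path
  have hblock : ∀ d t (ht : t < L), t + d = L - 1 →
      σ (some (j, ⟨t, ht⟩)) = (if t = 0 then none else some (j, ⟨t - 1, by omega⟩)) := by
    intro d
    induction d with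
    | zero =>
      intro t ht htd
      -- column `(j, L-1)`: its row `(j, L-1)` is taken by the hub column
      have htak : σ (some (j, ⟨t, ht⟩)) ≠ some (j, ⟨t, ht⟩) := by
        intro heq
        have : σ none = σ (some (j, ⟨t, ht⟩)) := by
          rw [hj, heq]; congr 1; ext <;> simp only; omega
        exact absurd (σ.injective this) (by simp)
      rcases hubMat_some_ne_zero (h (some (j, ⟨t, ht⟩))) with h1 | ⟨h2, h20⟩ | ⟨p, hp, hp1, hp2⟩
      · exact absurd h1 htak
      · simp only at h20
        rw [h2]; exact (if_pos h20).symm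
      · simp only at hp1 hp2
        rw [hp, if_neg (by omega)]
        congr 1; ext <;> simp only [hp1]; omega
    | succ d ih =>
      intro t ht htd
      have ih' := ih (t + 1) (by omega) (by omega)
      rw [if_neg (by omega)] at ih'
      have htak : σ (some (j, ⟨t, ht⟩)) ≠ some (j, ⟨t, ht⟩) := by
        intro heq
        have : σ (some (j, ⟨t + 1, by omega⟩)) = σ (some (j, ⟨t, ht⟩)) := by
          rw [ih', heq]; congr 1
        have := σ.injective this
        simp only [Option.some.injEq, Prod.mk.injEq, Fin.mk.injEq, true_and] at this
        omega
      rcases hubMat_some_ne_zero (h (some (j, ⟨t, ht⟩))) with h1 | ⟨h2, h20⟩ | ⟨p, hp, hp1, hp2⟩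
      · exact absurd h1 htak
      · simp only at h20
        rw [h2]; exact (if_pos h20).symm
      · simp only at hp1 hp2
        rw [hp, if_neg (by omega)]
        congr 1; ext <;> simp only [hp1]; omega
  have hblock' : ∀ t : Fin L, σ (some (j, t)) =
      (if t.val = 0 then none else some (j, ⟨t.val - 1, by omega⟩)) :=
    fun t => hblock (L - 1 - t.val) t.val t.isLt (by omega)
  -- other blocks: ascending induction shows every column is fixed
  have hother : ∀ (j' : Fin c), j' ≠ j → ∀ n (t : Fin L), t.val = n → σ (some (j', t)) = some (j', t) := by
    intro j' hj' n
    induction n with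
    | zero =>
      intro t ht0
      rcases hubMat_some_ne_zero (h (some (j', t))) with h1 | ⟨h2, -⟩ | ⟨p, hp, hp1, hp2⟩
      · exact h1
      · -- the hub row is taken by column `(j, 0)`
        have h0 := hblock' ⟨0, by omega⟩
        rw [if_pos rfl] at h0
        have := σ.injective (h2.trans h0.symm)
        simp only [Option.some.injEq, Prod.mk.injEq] at this
        exact absurd this.1 hj'
      · simp only at hp2; omega
    | succ n ih =>
      intro t htn
      rcases hubMat_some_ne_zero (h (some (j', t))) with h1 | ⟨-, h20⟩ | ⟨p, hp, hp1, hp2⟩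
      · exact h1
      · simp only at h20; omega
      · -- then column `p = (j', n)` is not fixed: contradiction with the induction hypothesis
        simp only at hp1 hp2
        have hpn : p.2.val = n := by omega
        have hp' : p = (j', ⟨n, by omega⟩) := by ext <;> simp [hp1, hpn]
        have hfix := ih ⟨n, by omega⟩ rfl
        rw [← hp'] at hfix
        have := σ.injective (hp.trans hfix.symm)
        rw [hp'] at this
        simp only [Option.some.injEq, Prod.mk.injEq, true_and] at this
        have := congrArg Fin.val this
        simp only at this
        omega
  -- assemble
  ext1 y
  rcases y with _ | ⟨j', t⟩
  · rw [hj, hubSwitch_none]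
  · rw [hubSwitch_some]
    by_cases hjj : j' = j
    · subst hjj
      rw [if_pos rfl, hblock' t]
    · rw [if_neg hjj, hother j' hjj t.val t rfl]

/-! ## §3 The permanent of the hub matrix -/

/-- Entries picked by the `j`-th switch in a block column. [folklore] -/
theorem hubMat_hubSwitch_some (hL : 1 ≤ L) (j : Fin c) (j' : Fin c) (t : Fin L) :
    hubMat z ℓ (hubSwitch hL j (some (j', t))) (some (j', t)) =
      if j' = j then (if t.val = 0 then z else ℓ (j, ⟨t.val - 1, by omega⟩)) else z := by
  rw [hubSwitch_some]
  by_cases hj : j' = j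
  · subst hj
    rw [if_pos rfl, if_pos rfl]
    by_cases ht : t.val = 0
    · rw [if_pos ht, if_pos ht]
      simp only [hubMat]
      rw [if_pos ht]
    · rw [if_neg ht, if_neg ht]
      simp only [hubMat]
      split_ifs with hA hB
      · exact absurd (congrArg (fun q : Fin c × Fin L => q.2.val) hA) (by simp only; omega)
      · rfl
      · exact absurd ⟨by simp, by omega⟩ hB
  · rw [if_neg hj, if_neg hj]
    simp [hubMat]

/-- Splitting a double product with one distinguished outer index. [folklore] -/
theorem prod_prod_ite_eq {α β : Type*} [Fintype α] [DecidableEq α] [Fintype β] (j : α)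
    (A : β → R) (z : R) :
    (∏ x : α, ∏ t : β, (if x = j then A t else z)) =
      (∏ t, A t) * (z ^ Fintype.card β) ^ (Fintype.card α - 1) := by
  rw [← Finset.mul_prod_erase Finset.univ _ (Finset.mem_univ j)]
  have h1 : (∏ t : β, (if j = j then A t else z)) = ∏ t, A t :=
    Finset.prod_congr rfl (fun t _ => if_pos rfl)
  have h2 : ∀ x ∈ Finset.univ.erase j, (∏ t : β, (if x = j then A t else z)) = z ^ Fintype.card β :=
    fun x hx => by
      rw [Finset.prod_congr rfl (fun t _ => if_neg (Finset.ne_of_mem_erase hx)), Finset.prod_const,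
        Finset.card_univ]
  rw [h1, Finset.prod_eq_pow_card h2, Finset.card_erase_of_mem (Finset.mem_univ j), Finset.card_univ]

/-- The product along the `j`-th switch: `z^{(c-1)L+1} · ∏_t ℓ (j,t)`. [folklore] -/
theorem prod_hubSwitch (hL : 1 ≤ L) (j : Fin c) :
    (∏ y, hubMat z ℓ (hubSwitch hL j y) y) = z ^ ((c - 1) * L + 1) * ∏ t, ℓ (j, t) := by
  classical
  obtain ⟨L', rfl⟩ : ∃ L', L = L' + 1 := ⟨L - 1, by omega⟩
  rw [Fintype.prod_option, hubSwitch_none, Fintype.prod_prod_type]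
  -- hub column
  have hhub : hubMat z ℓ (some (j, ⟨L' + 1 - 1, by omega⟩)) none = ℓ (j, Fin.last L') := by
    simp only [hubMat]
    rw [if_pos (by simp)]
    congr 1
  rw [hhub]
  simp_rw [hubMat_hubSwitch_some]
  -- block `j` and the other blocks
  have hcolj : (∏ t : Fin (L' + 1), (if t.val = 0 then z else ℓ (j, ⟨t.val - 1, by omega⟩))) =
      z * ∏ t : Fin L', ℓ (j, t.castSucc) := by
    rw [Fin.prod_univ_succ]
    congr 1
  rw [prod_prod_ite_eq, hcolj, Fintype.card_fin, Fintype.card_fin,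
    Fin.prod_univ_castSucc (fun t => ℓ (j, t)), ← pow_mul]
  ring

/-- **The permanent of the hub matrix**: `Σ_j z^{(c-1)L+1} · ∏_t ℓ (j,t)`. [folklore] -/
theorem permanent_hubMat (hL : 1 ≤ L) (z : R) (ℓ : Fin c × Fin L → R) :
    (hubMat z ℓ).permanent = ∑ j : Fin c, z ^ ((c - 1) * L + 1) * ∏ t, ℓ (j, t) := by
  classical
  unfold Matrix.permanent
  -- only switches contribute
  rw [← Finset.sum_subset (Finset.subset_univ (Finset.univ.image (hubSwitch (c := c) hL)))
      (fun σ _ hσ => ?_)]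
  · rw [Finset.sum_image (fun j _ j' _ h => hubSwitch_injective hL h)]
    exact Finset.sum_congr rfl fun j _ => prod_hubSwitch hL j
  · -- a non-switch has a zero factor
    by_contra hne
    have hall : ∀ y, hubMat z ℓ (σ y) y ≠ 0 := fun y hy =>
      hne (Finset.prod_eq_zero (Finset.mem_univ y) hy)
    obtain ⟨j, rfl⟩ := eq_hubSwitch_of_forall_ne_zero hL σ hall
    exact hσ (Finset.mem_image_of_mem _ (Finset.mem_univ j))

/-- Permanents are invariant under re-indexing along an equivalence. [folklore] -/
theorem permanent_submatrix_equiv {m n : Type*} [Fintype m] [DecidableEq m] [Fintype n]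
    [DecidableEq n] (e : m ≃ n) (M : Matrix n n R) : (M.submatrix e e).permanent = M.permanent := by
  unfold Matrix.permanent
  refine Fintype.sum_equiv (Equiv.permCongr e) _ _ fun σ => ?_
  refine Fintype.prod_equiv e _ _ fun i => ?_
  simp [Matrix.submatrix_apply, Equiv.permCongr_apply]

end Hub

end

end Summit.ValiantsHypothesis.ValiantsHypothesis.Theorems.GeneratorObstructions.PerGenDegreeSuperQP
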